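import Literature.MathematicalPhysics.QuantumFieldTheory.Balaban1983to89.B3MultiscaleFields

/-!
# `Balaban1983to89.B1Eq31Concrete` — T. Bałaban, *(Higgs)₂,₃ quantum fields in a finite volume. I. A lower bound*,
Commun. Math. Phys. **85** (1982) 603–626 [Balaban1982Higgs1], (3.1)–(3.5) p. 613 and (3.27)–(3.29) p. 617: the
CHARACTERISTIC FUNCTIONS `χ₀(A)`, `χ₀(φ)`, `χ₁(B)`, `χ₁(ψ)`, `χ_k(A)`, `χ_k(φ)` of the small-field restrictions and the
background ("minimizing") configurations `A^{(k),ε}`, `φ^{(k),ε}` AS CONCRETE FUNCTIONS on the (Higgs)₂,₃ carriers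
`…HiggsLattice` / `…HiggsAveraging` / `…HiggsCovariance` / `…B3MultiscaleFields`, with the facts the lower-bound
step (3.6) needs about them: values in `[0, 1]` and joint measurability in the fields

statement-level skeleton of published theorems with citation tags; proofs where landed; nothing here is a claim about the Yang–Mills mass gap

PDF held: `paper:balaban1982-cmp85-higgs23-i` (journal page = PDF page + 602).  Displays (3.1)–(3.5) and (3.27)–(3.29)
read from the ×2 renders `run/shared/lean/pub/pub-balaban/b2b-balaban-ref1/pages/1982-cmp85-higgs23-I/
1982-cmp85-higgs23-I-p011-x2.png` (p. 613) and `…-p015-x2.png` (p. 617), never from the OCR layer.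

CITATION HEADER (lean-in-tree rule).  lit-balaban typed skeleton (HOME `run/shared/lean/pub/lit-balaban/`), SKELETON
rows **B1.Eq3.1**, **B1.Eq3.1-3.2**, **B1.Eq3.3**, **B1.Eq3.4-3.5**, **B1.Eq3.27**, **B1.Eq3.27-3.28**, **B1.Eq3.29**
(owners r01/r12/r14).  The rows' declarations OF RECORD are the DICTIONARY forms of reader r14
(`B1LowerBound.SmallFieldAt`, `B1LowerBound.ChiK`: the two inequalities at one point / at every point, over abstract
size functions `|F(x)|`, `|(ΔF)(x)|`; `B1LowerBound.bgField`: the shape `a_kℓ^{−2}G(Q^*ψ)` over abstract linear maps)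
— this module is their CONCRETE INSTANCE for the model and is not a restatement: the abstract predicates are used by
name (`chi0A_eq_one_iff`, `chiKA_eq_one_iff`, … : *the concrete χ equals 1 iff r14's `ChiK` holds*).
WHAT IS REPRODUCED.  p. 613, verbatim: *"In the first step we introduce the characteristic functions
χ₀(A) = Π_{x∈T_ε} χ({|A(x)| ≤ ε^{−(d−2)/2}p(ε)}) χ({|(Δ^εA)(x)| ≤ ε^{−(d+2)/2}p(ε)}), p(ε) = b₀(1 + log ε⁻¹)^p, (3.1)
χ₀(φ) = Π_{x∈T_ε} χ({|φ(x)| ≤ ε^{−(d−2)/2}p(ε)}) χ({|(Δ^ε_Aφ)(x)| ≤ ε^{−(d+2)/2}p(ε)}). (3.2)  The restrictions on the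
fields B, ψ are made by the means of the fields B^{(1),ε}, ψ^{(1),ε}: B^{(1),ε} = a(Lε)^{−2}G^ε_1Q^*B,
ψ^{(1),ε} = a(Lε)^{−2}G^ε_1(B^{(1),ε})Q^*(B^{(1),ε})ψ. (3.3)  Of course they are defined on the ε-lattice T_ε. We
introduce the characteristic functions χ₁(B) = Π_{x∈T_ε} χ({|B^{(1),ε}(x)| ≤ (Lε)^{−(d−2)/2}p(Lε)})
·χ({|(Δ^εB^{(1),ε})(x)| ≤ (Lε)^{−(d+2)/2}p(Lε)}), (3.4)  χ₁(ψ) = Π_{x∈T_ε} χ({|ψ^{(1),ε}(x)| ≤ (Lε)^{−(d−2)/2}p(Lε)})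
·χ({|(Δ^ε_{B^{(1),ε}}ψ^{(1),ε})(x)| ≤ (Lε)^{−(d+2)/2}p(Lε)}), (3.5)"*; p. 617, verbatim: *"where
χ_k(A) = Π_{x∈T_ε} χ({|A^{(k),ε}(x)| ≤ (L^kε)^{−(d−2)/2}p(L^kε)}) ·χ({|(Δ^εA^{(k),ε})(x)| ≤ (L^kε)^{−(d+2)/2}p(L^kε)}), (3.27)
χ_k(φ) = Π_{x∈T_ε} χ({|φ^{(k),ε}(x)| ≤ (L^kε)^{−(d−2)/2}p(L^kε)}) ·χ({|(Δ^ε_{A^{(k),ε}}φ^{(k),ε})(x)| ≤ (L^kε)^{−(d+2)/2}p(L^kε)}), (3.28)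
A^{(k),ε} = a_k(L^kε)^{−2}G^ε_kQ^*_kA, φ^{(k),ε} = a_k(L^kε)^{−2}G^ε_k(A^{(k),ε})Q^*_k(A^{(k),ε})φ. (3.29)"*.
HOW IT IS TYPED (reuse; nothing re-declared).  `χ({r ≤ t})` is the number `ind r t ∈ {0, 1}`; the printed products are
`chiProd`/`chiSmall` (§1, generic over a finite index set, thresholds `ℓ^{−(d∓2)/2}·p` kept separate from the value `p`
because after the rescaling of p. 613 the thresholds are `p(ε)` on the UNIT lattice, (3.8)–(3.9)).  The fields: `A(x)`
is the `ℝ^d`-valued site function `B3MultiscaleFields.toSite A` (p. 608 *"N = d"*), `|·|` the Euclidean norms of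
`ℝ^d`/`ℝ^N`; `−Δ^η_A` is the typer's `HiggsCovariance.covLaplacianN` on the whole torus (`Ω = T`), and `−Δ^η` on
`ℝ^d`-valued site functions is the same operator at the trivial coupling `B3MultiscaleFields.zeroCharge` (`U ≡ 1`)
(`negLap`; explicit formulas `covLaplacianN_univ_apply`, `negLap_apply` PROVED) — `|(Δf)(x)| = |(−Δf)(x)|`.  (3.29):
`A^{(k),ε}` IS r15's `B3MultiscaleFields.topPiece μ₀² a k A` (= `a_k(L^kε)^{−2}G^ε_kQ^*_kA` with the vector-field
propagator `HiggsCovariance.propagatorK` at the zero external field, mass `μ₀²`), reused by name; `φ^{(k),ε}` is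
`bgScalar` = r14's `bgField` at the concrete `G^ε_k(A^{(k),ε})` (`propagatorK`, scalar mass `m²`) and `Q_k^*(A^{(k),ε})`
(`HiggsCovariance.avgQkAdj`).  Then (3.1)/(3.2) = `chi0A`/`chi0φ` (any level and thresholds; the printed instance is
`ℓ = ε`, `p = p(ε) = B2.pFn b₀ p ε`), (3.27)/(3.28) = `chiKA`/`chiKφ` = the (3.1)/(3.2)-shapes evaluated at the
background fields (3.29), and (3.4)/(3.5) = their case `k = 1` (`chi1B`, `chi1ψ`; (3.3) = `bgVec1`, `bgScalar1`).
PROVED: the explicit Laplacian formulas; `χ ∈ [0, 1]` for all of them; `χ = 1 ↔` r14's `ChiK` (the dictionary rows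
instantiated); joint continuity of `(A, φ) ↦ (−Δ^η_Aφ)(x)` and the joint MEASURABILITY of `(A, φ) ↦ χ₀(A)χ₀(φ)`
(`measurable_chi0`) — the hypothesis of the concrete (3.6) (`B1Ineq36HiggsModel.lowerStep36`, typer) on the inner
weight; the outer weights `χ₁(B)χ₁(ψ)` enter (3.6) only through `0 ≤ χ₁ ≤ 1` (`chi1_mem_Icc`).
DELIBERATELY NOT HERE: (3.6) itself (row B1.Eq3.6: mechanism `B1Ineq36LowerStep`, r14; model instance
`B1Ineq36HiggsModel`, typer — a one-line corollary `lowerStep36_printed` combining the two modules is filed there);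
the rescaled form (3.8)–(3.9) (needs `HiggsRescaling`); invertibility of the operators behind `G^ε_k` (a STATEMENT of
Props. 2.1–2.3, rows B1.Prop2.x; `propagatorK` is `Ring.inverse`, value `0` off invertibility, exactly as in
`HiggsCovariance`); measurability of `χ_k(φ)` in `(A, φ)` jointly for `k ≥ 1` (not needed by (3.6)).
Unit `lit-balaban-typer` gen 3 (literature-prover-lit-balaban-typer-g3-0); HOME/FILED.md records the proposal.
-/

open scoped BigOperators
open _root_.MeasureTheory

namespace Literature.MathematicalPhysics.QuantumFieldTheory.Balaban1983to89.B1Eq31Concrete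

open Literature.MathematicalPhysics.QuantumFieldTheory.Balaban1983to89.HiggsLattice
open Literature.MathematicalPhysics.QuantumFieldTheory.Balaban1983to89.HiggsAveraging
open Literature.MathematicalPhysics.QuantumFieldTheory.Balaban1983to89.HiggsCovariance
open Literature.MathematicalPhysics.QuantumFieldTheory.Balaban1983to89.B3MultiscaleFields
  (toSite ofSite toSite_ofSite zeroCharge zeroCharge_U topPiece fluctOp)

/-! ## 1. The characteristic function of a small-field event (the common shape of (3.1)–(3.5), (3.27)–(3.28)) -/

section Generic

/-- `χ({r ≤ t})`: the characteristic function of the event *"the size `r` does not exceed the threshold `t`"* as the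
number `1` or `0` — the factors of the products (3.1)–(3.5) p. 613. [cite: Balaban1982Higgs1, (3.1) p.613] -/
noncomputable def ind (r t : ℝ) : ℝ := if r ≤ t then 1 else 0

/-- `χ({r ≤ t}) = 1` iff `r ≤ t`. [cite: Balaban1982Higgs1, (3.1) p.613] -/
theorem ind_eq_one_iff (r t : ℝ) : ind r t = 1 ↔ r ≤ t := by
  unfold ind
  split_ifs with h
  · simp [h]
  · simp [h]

/-- `χ({r ≤ t}) = 0` iff `t < r`. [cite: Balaban1982Higgs1, (3.1) p.613] -/
theorem ind_eq_zero_iff (r t : ℝ) : ind r t = 0 ↔ t < r := by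
  unfold ind
  split_ifs with h
  · simp [h]
  · simp [not_le.mp h]

/-- `0 ≤ χ ≤ 1`. [cite: Balaban1982Higgs1, (3.1) p.613] -/
theorem ind_mem_Icc (r t : ℝ) : ind r t ∈ Set.Icc (0 : ℝ) 1 := by
  unfold ind
  split_ifs <;> simp

/-- Two characteristic functions multiply to the characteristic function of the conjunction. [cite: Balaban1982Higgs1, (3.1) p.613] -/
theorem ind_mul_ind (r t r' t' : ℝ) : ind r t * ind r' t' = if r ≤ t ∧ r' ≤ t' then 1 else 0 := by
  unfold ind
  split_ifs <;> simp_all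

variable {X : Type} [Fintype X]

/-- The printed shape of (3.1)–(3.5), (3.27)–(3.28): `Π_{x∈T} χ({|F(x)| ≤ t₁}) χ({|(ΔF)(x)| ≤ t₂})` for size functions
`x ↦ |F(x)|` (`absF`) and `x ↦ |(ΔF)(x)|` (`absLap`) on a finite set of sites and two thresholds. [cite: Balaban1982Higgs1, (3.1) p.613] -/
noncomputable def chiProd (t₁ t₂ : ℝ) (absF absLap : X → ℝ) : ℝ :=
  ∏ x, ind (absF x) t₁ * ind (absLap x) t₂

/-- The product of characteristic functions is the characteristic function of *"the restriction holds at every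
point"*: `Π_x χ(…)χ(…) = 1` if `∀ x, |F(x)| ≤ t₁ ∧ |(ΔF)(x)| ≤ t₂`, else `0`. PROVED. [cite: Balaban1982Higgs1, (3.1) p.613] -/
theorem chiProd_eq_ite (t₁ t₂ : ℝ) (absF absLap : X → ℝ) :
    chiProd t₁ t₂ absF absLap = if ∀ x, absF x ≤ t₁ ∧ absLap x ≤ t₂ then 1 else 0 := by
  unfold chiProd
  simp_rw [ind_mul_ind]
  rw [Finset.prod_boole]
  simp

/-- `0 ≤ Π_x χ(…)χ(…) ≤ 1`. [cite: Balaban1982Higgs1, (3.1) p.613] -/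
theorem chiProd_mem_Icc (t₁ t₂ : ℝ) (absF absLap : X → ℝ) : chiProd t₁ t₂ absF absLap ∈ Set.Icc (0 : ℝ) 1 := by
  rw [chiProd_eq_ite]
  split_ifs <;> simp

/-- `Π_x χ(…)χ(…) = 1 ↔ ∀ x, |F(x)| ≤ t₁ ∧ |(ΔF)(x)| ≤ t₂`. [cite: Balaban1982Higgs1, (3.1) p.613] -/
theorem chiProd_eq_one_iff (t₁ t₂ : ℝ) (absF absLap : X → ℝ) :
    chiProd t₁ t₂ absF absLap = 1 ↔ ∀ x, absF x ≤ t₁ ∧ absLap x ≤ t₂ := by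
  rw [chiProd_eq_ite]
  split_ifs with h
  · simp [h]
  · simp [h]

/-- **Measurability of the printed products** in any parameter on which the size functions depend measurably (each
factor is the indicator of a sub-level set of a measurable real function). PROVED. [cite: Balaban1982Higgs1, (3.1) p.613] -/
theorem measurable_chiProd {Ω : Type*} [MeasurableSpace Ω] (t₁ t₂ : ℝ) {F G : Ω → X → ℝ}
    (hF : ∀ x, Measurable fun ω => F ω x) (hG : ∀ x, Measurable fun ω => G ω x) :
    Measurable fun ω => chiProd t₁ t₂ (F ω) (G ω) := by
  unfold chiProd ind
  refine Finset.measurable_prod _ fun x _ => ?_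
  exact (Measurable.ite (measurableSet_le (hF x) measurable_const) measurable_const measurable_const).mul
    (Measurable.ite (measurableSet_le (hG x) measurable_const) measurable_const measurable_const)

/-- The threshold `ℓ^{−(d−2)/2}·p` for `|F(x)|` at scale `ℓ` ((3.1): `ℓ = ε`, `p = p(ε)`; (3.4): `ℓ = Lε`; (3.27):
`ℓ = L^kε`; (3.8): `ℓ = 1`, `p = p(ε)`). [cite: Balaban1982Higgs1, (3.1) p.613] -/
noncomputable def thrF (d : ℕ) (ℓ p : ℝ) : ℝ := ℓ ^ (-(((d : ℝ) - 2) / 2)) * p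

/-- The threshold `ℓ^{−(d+2)/2}·p` for `|(ΔF)(x)|` at scale `ℓ`. [cite: Balaban1982Higgs1, (3.1) p.613] -/
noncomputable def thrLap (d : ℕ) (ℓ p : ℝ) : ℝ := ℓ ^ (-(((d : ℝ) + 2) / 2)) * p

/-- On the unit lattice the thresholds are `p` itself ((3.8)–(3.9) p. 613: *"|A(x)| ≤ p(ε), |(ΔA)(x)| ≤ p(ε)"*). [cite: Balaban1982Higgs1, (3.8) p.613] -/
theorem thrF_one (d : ℕ) (p : ℝ) : thrF d 1 p = p := by simp [thrF]

/-- On the unit lattice the thresholds are `p` itself ((3.8)–(3.9) p. 613). [cite: Balaban1982Higgs1, (3.9) p.613] -/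
theorem thrLap_one (d : ℕ) (p : ℝ) : thrLap d 1 p = p := by simp [thrLap]

/-- The small-field characteristic function at scale `ℓ` with value `p`:
`Π_x χ({|F(x)| ≤ ℓ^{−(d−2)/2}p}) χ({|(ΔF)(x)| ≤ ℓ^{−(d+2)/2}p})` — the shape shared by (3.1), (3.2), (3.4), (3.5),
(3.27), (3.28). [cite: Balaban1982Higgs1, (3.27) p.617] -/
noncomputable def chiSmall (d : ℕ) (ℓ p : ℝ) (absF absLap : X → ℝ) : ℝ :=
  chiProd (thrF d ℓ p) (thrLap d ℓ p) absF absLap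

/-- `0 ≤ χ ≤ 1`. [cite: Balaban1982Higgs1, (3.27) p.617] -/
theorem chiSmall_mem_Icc (d : ℕ) (ℓ p : ℝ) (absF absLap : X → ℝ) :
    chiSmall d ℓ p absF absLap ∈ Set.Icc (0 : ℝ) 1 :=
  chiProd_mem_Icc _ _ _ _

/-- **The concrete χ instantiates r14's dictionary**: `χ = 1` iff the restriction `B1LowerBound.SmallFieldAt d ℓ p`
((3.1)/(3.27) at one point) holds at every point. PROVED. [cite: Balaban1982Higgs1, (3.27) p.617] -/
theorem chiSmall_eq_one_iff (d : ℕ) (ℓ p : ℝ) (absF absLap : X → ℝ) :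
    chiSmall d ℓ p absF absLap = 1 ↔ ∀ x, B1LowerBound.SmallFieldAt d ℓ p (absF x) (absLap x) :=
  chiProd_eq_one_iff _ _ _ _

/-- With the printed value `p = p(ℓ) = b₀(1 + log ℓ⁻¹)^p` (`B2.pFn`): `χ = 1 ↔ B1LowerBound.ChiK` (r14's
`χ_k = 1`). PROVED. [cite: Balaban1982Higgs1, (3.27) p.617] -/
theorem chiSmall_pFn_eq_one_iff (d : ℕ) (b₀ p ℓ : ℝ) (absF absLap : X → ℝ) :
    chiSmall d ℓ (B2.pFn b₀ p ℓ) absF absLap = 1 ↔ B1LowerBound.ChiK d b₀ p ℓ absF absLap :=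
  chiProd_eq_one_iff _ _ _ _

/-- Measurability of `χ` in a parameter (from `measurable_chiProd`). [cite: Balaban1982Higgs1, (3.27) p.617] -/
theorem measurable_chiSmall {Ω : Type*} [MeasurableSpace Ω] (d : ℕ) (ℓ p : ℝ) {F G : Ω → X → ℝ}
    (hF : ∀ x, Measurable fun ω => F ω x) (hG : ∀ x, Measurable fun ω => G ω x) :
    Measurable fun ω => chiSmall d ℓ p (F ω) (G ω) :=
  measurable_chiProd _ _ hF hG

end Generic

variable {P : Params}

/-! ## 2. The Laplace operators entering (3.1)–(3.2): `−Δ^η_A` on the whole torus and `−Δ^η` -/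

section Laplacians

variable {k N : ℕ}

/-- **`−Δ^η_A` on the whole torus, explicitly**: the typer's Neumann operator `HiggsCovariance.covLaplacianN` at
`Ω = T^{(k)}` is `(−Δ^η_Aφ)(x) = η⁻² Σ_μ [(φ(x) − U(A_{⟨x,x+ηe_μ⟩})φ(x+ηe_μ)) + (φ(x) − U(−A_{⟨x−ηe_μ,x⟩})φ(x−ηe_μ))]`
(`U(A)* = U(−A)`, p. 605) — the covariant Laplace operator `−Δ^ε_A = D^{ε*}_AD^ε_A` of (1.11) p. 605 whose values
enter (3.2). PROVED (unfolding). [cite: Balaban1982Higgs1, (1.11) p.605] -/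
theorem covLaplacianN_univ_apply (C : ChargeData N) (A : VecField P k) (φ : ScalarField P k N) (x : Site P k) :
    covLaplacianN C Finset.univ A φ x = ((P.mesh k)⁻¹ ^ 2) • ∑ μ : Fin P.d,
      ((φ x - C.U (P.mesh k) (A ⟨x, μ⟩) (φ (x.shift μ)))
        + (φ x - C.U (P.mesh k) (-(A ⟨x.unshift μ, μ⟩)) (φ (x.unshift μ)))) := by
  simp only [covLaplacianN, fwdTerm, bwdTerm, Finset.mem_univ, and_self, if_true, LinearMap.pi_apply,
    LinearMap.smul_apply, LinearMap.coe_sum, Finset.sum_apply, LinearMap.add_apply, LinearMap.sub_apply,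
    LinearMap.coe_comp, Function.comp_apply, LinearMap.coe_proj, Function.eval, ContinuousLinearMap.coe_coe,
    C.star_U]

/-- `−Δ^η` on `ℝ^d`-valued site functions (p. 605: *"−Δ^ε = ∂^{ε*}∂^ε is the Laplace operator on the torus T_ε"*,
acting componentwise on `x ↦ (A_μ(x))_μ`): the operator `covLaplacianN` on the whole torus at the trivial coupling
`zeroCharge` (`U ≡ 1`, the *"external vector field A = 0"* device of p. 608).  Its values enter (3.1), (3.4), (3.27):
`|(Δ^ηF)(x)| = ‖negLap F x‖`. [cite: Balaban1982Higgs1, (1.11) p.605] -/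
noncomputable def negLap (F : ScalarField P k P.d) : ScalarField P k P.d :=
  covLaplacianN (zeroCharge P.d) Finset.univ (0 : VecField P k) F

/-- **`−Δ^η` explicitly**: `(−Δ^ηF)(x) = η⁻² Σ_μ [(F(x) − F(x+ηe_μ)) + (F(x) − F(x−ηe_μ))]`. PROVED. [cite: Balaban1982Higgs1, (1.11) p.605] -/
theorem negLap_apply (F : ScalarField P k P.d) (x : Site P k) :
    negLap F x = ((P.mesh k)⁻¹ ^ 2) • ∑ μ : Fin P.d, ((F x - F (x.shift μ)) + (F x - F (x.unshift μ))) := by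
  unfold negLap
  rw [covLaplacianN_univ_apply]
  simp [zeroCharge_U]

/-- `A ↦ U(A) = exp(qηeA)` (p. 605) is continuous. [cite: Balaban1982Higgs1, (1.7) p.605] -/
theorem continuous_chargeU (C : ChargeData N) (η : ℝ) : Continuous fun t : ℝ => C.U η t := by
  letI : NormedAlgebra ℚ (EuclideanSpace ℝ (Fin N) →L[ℝ] EuclideanSpace ℝ (Fin N)) :=
    NormedAlgebra.restrictScalars ℚ ℝ _
  change Continuous fun t : ℝ => NormedSpace.exp ((η * C.e * t) • C.q)
  exact NormedSpace.exp_continuous.comp ((continuous_const.mul continuous_id).smul continuous_const)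

/-- **`(A, φ) ↦ (−Δ^η_Aφ)(x)` is jointly continuous** (the transports `U(A_b) = exp(qηeA_b)` depend continuously on the
bond variables) — whence the measurability of `χ₀(φ)` (3.2) in `(A, φ)`. PROVED. [cite: Balaban1982Higgs1, (3.2) p.613] -/
theorem continuous_covLaplacianN_apply (C : ChargeData N) (x : Site P k) :
    Continuous fun p : VecField P k × ScalarField P k N => covLaplacianN C Finset.univ p.1 p.2 x := by
  simp_rw [covLaplacianN_univ_apply]
  have hA : ∀ b : PBond P k, Continuous fun p : VecField P k × ScalarField P k N => p.1 b :=
    fun b => (continuous_apply b).comp continuous_fst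
  have hφ : ∀ y : Site P k, Continuous fun p : VecField P k × ScalarField P k N => p.2 y :=
    fun y => (continuous_apply y).comp continuous_snd
  have hfwd : ∀ μ : Fin P.d, Continuous fun p : VecField P k × ScalarField P k N =>
      C.U (P.mesh k) (p.1 ⟨x, μ⟩) (p.2 (x.shift μ)) :=
    fun μ => ((continuous_chargeU C (P.mesh k)).comp (hA ⟨x, μ⟩)).clm_apply (hφ (x.shift μ))
  have hbwd : ∀ μ : Fin P.d, Continuous fun p : VecField P k × ScalarField P k N =>
      C.U (P.mesh k) (-(p.1 ⟨x.unshift μ, μ⟩)) (p.2 (x.unshift μ)) :=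
    fun μ => ((continuous_chargeU C (P.mesh k)).comp (hA ⟨x.unshift μ, μ⟩).neg).clm_apply (hφ (x.unshift μ))
  have hterm : ∀ μ : Fin P.d, Continuous fun p : VecField P k × ScalarField P k N =>
      (p.2 x - C.U (P.mesh k) (p.1 ⟨x, μ⟩) (p.2 (x.shift μ)))
        + (p.2 x - C.U (P.mesh k) (-(p.1 ⟨x.unshift μ, μ⟩)) (p.2 (x.unshift μ))) :=
    fun μ => ((hφ x).sub (hfwd μ)).add ((hφ x).sub (hbwd μ))
  exact (continuous_finsetSum _ fun μ _ => hterm μ).const_smul ((P.mesh k)⁻¹ ^ 2)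

/-- `F ↦ (−Δ^ηF)(x)` is continuous. [cite: Balaban1982Higgs1, (1.11) p.605] -/
theorem continuous_negLap_apply (x : Site P k) : Continuous fun F : ScalarField P k P.d => negLap F x := by
  simp_rw [negLap_apply]
  have hF : ∀ y : Site P k, Continuous fun F : ScalarField P k P.d => F y := fun y => continuous_apply y
  have hterm : ∀ μ : Fin P.d, Continuous fun F : ScalarField P k P.d =>
      (F x - F (x.shift μ)) + (F x - F (x.unshift μ)) :=
    fun μ => ((hF x).sub (hF (x.shift μ))).add ((hF x).sub (hF (x.unshift μ)))
  exact (continuous_finsetSum _ fun μ _ => hterm μ).const_smul ((P.mesh k)⁻¹ ^ 2)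

/-- `A ↦ (x ↦ (A_μ(x))_μ)` (p. 608) is continuous (coordinatewise evaluation). [cite: Balaban1982Higgs1, p.608] -/
theorem continuous_toSite : Continuous (toSite : VecField P k → ScalarField P k P.d) :=
  continuous_pi fun x =>
    (PiLp.continuous_toLp 2 (fun _ : Fin P.d => ℝ)).comp (continuous_pi fun μ => continuous_apply (⟨x, μ⟩ : PBond P k))

end Laplacians

/-! ## 3. (3.1)–(3.2): `χ₀(A)`, `χ₀(φ)` -/

section ChiZero

variable {k N : ℕ}

/-- **(3.1) p. 613**: `χ₀(A) = Π_{x∈T} χ({|A(x)| ≤ ℓ^{−(d−2)/2}p}) χ({|(Δ^ηA)(x)| ≤ ℓ^{−(d+2)/2}p})` for a vector field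
`A` on a lattice of the family (regarded as `x ↦ (A_μ(x))_μ ∈ ℝ^d`, Euclidean norms), at scale parameter `ℓ` and value
`p`.  PRINTED INSTANCE: the `ε`-lattice `T_ε = T^{(0)}`, `ℓ = ε = P.mesh 0`, `p = p(ε) = B2.pFn b₀ p ε`
(`chi0A_printed`); after the rescaling to the unit lattice `ℓ = 1` with the same `p(ε)` ((3.8)). [cite: Balaban1982Higgs1, (3.1) p.613] -/
noncomputable def chi0A (ℓ p : ℝ) (A : VecField P k) : ℝ :=
  chiSmall P.d ℓ p (fun x => ‖toSite A x‖) (fun x => ‖negLap (toSite A) x‖)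

/-- **(3.2) p. 613**: `χ₀(φ) = Π_{x∈T} χ({|φ(x)| ≤ ℓ^{−(d−2)/2}p}) χ({|(Δ^η_Aφ)(x)| ≤ ℓ^{−(d+2)/2}p})` — a function of
the PAIR `(A, φ)` (the covariant Laplacian depends on `A`).  PRINTED INSTANCE: `ℓ = ε`, `p = p(ε)`. [cite: Balaban1982Higgs1, (3.2) p.613] -/
noncomputable def chi0φ (C : ChargeData N) (ℓ p : ℝ) (A : VecField P k) (φ : ScalarField P k N) : ℝ :=
  chiSmall P.d ℓ p (fun x => ‖φ x‖) (fun x => ‖covLaplacianN C Finset.univ A φ x‖)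

/-- (3.1) with its printed thresholds on `T_ε`: `ℓ = ε`, `p(ε) = b₀(1 + log ε⁻¹)^p`, written out. [cite: Balaban1982Higgs1, (3.1) p.613] -/
theorem chi0A_printed (b₀ p : ℝ) (A : VecField P 0) :
    chi0A (P.mesh 0) (B2.pFn b₀ p (P.mesh 0)) A
      = ∏ x : Site P 0,
          ind ‖toSite A x‖ (P.mesh 0 ^ (-(((P.d : ℝ) - 2) / 2)) * (b₀ * (1 + Real.log (P.mesh 0)⁻¹) ^ p))
            * ind ‖negLap (toSite A) x‖ (P.mesh 0 ^ (-(((P.d : ℝ) + 2) / 2)) * (b₀ * (1 + Real.log (P.mesh 0)⁻¹) ^ p)) := by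
  simp only [chi0A, chiSmall, chiProd, thrF, thrLap, B2.pFn]

/-- (3.2) with its printed thresholds on `T_ε`, written out. [cite: Balaban1982Higgs1, (3.2) p.613] -/
theorem chi0φ_printed (C : ChargeData N) (b₀ p : ℝ) (A : VecField P 0) (φ : ScalarField P 0 N) :
    chi0φ C (P.mesh 0) (B2.pFn b₀ p (P.mesh 0)) A φ
      = ∏ x : Site P 0,
          ind ‖φ x‖ (P.mesh 0 ^ (-(((P.d : ℝ) - 2) / 2)) * (b₀ * (1 + Real.log (P.mesh 0)⁻¹) ^ p))
            * ind ‖covLaplacianN C Finset.univ A φ x‖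
                (P.mesh 0 ^ (-(((P.d : ℝ) + 2) / 2)) * (b₀ * (1 + Real.log (P.mesh 0)⁻¹) ^ p)) := by
  simp only [chi0φ, chiSmall, chiProd, thrF, thrLap, B2.pFn]

/-- `0 ≤ χ₀(A) ≤ 1`. [cite: Balaban1982Higgs1, (3.1) p.613] -/
theorem chi0A_mem_Icc (ℓ p : ℝ) (A : VecField P k) : chi0A ℓ p A ∈ Set.Icc (0 : ℝ) 1 :=
  chiSmall_mem_Icc _ _ _ _ _

/-- `0 ≤ χ₀(φ) ≤ 1`. [cite: Balaban1982Higgs1, (3.2) p.613] -/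
theorem chi0φ_mem_Icc (C : ChargeData N) (ℓ p : ℝ) (A : VecField P k) (φ : ScalarField P k N) :
    chi0φ C ℓ p A φ ∈ Set.Icc (0 : ℝ) 1 :=
  chiSmall_mem_Icc _ _ _ _ _

/-- **`χ₀(A) = 1 ↔ χ_0(A) = 1` in r14's dictionary** (`B1LowerBound.ChiK` at the size functions `|A(x)|`,
`|(Δ^ηA)(x)|` of the model): the row B1.Eq3.1 declaration of record, instantiated. PROVED. [cite: Balaban1982Higgs1, (3.1) p.613] -/
theorem chi0A_eq_one_iff (b₀ p ℓ : ℝ) (A : VecField P k) :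
    chi0A ℓ (B2.pFn b₀ p ℓ) A = 1
      ↔ B1LowerBound.ChiK P.d b₀ p ℓ (fun x => ‖toSite A x‖) (fun x => ‖negLap (toSite A) x‖) :=
  chiSmall_pFn_eq_one_iff _ _ _ _ _ _

/-- **`χ₀(φ) = 1 ↔` r14's `ChiK`** at the size functions `|φ(x)|`, `|(Δ^η_Aφ)(x)|`. PROVED. [cite: Balaban1982Higgs1, (3.2) p.613] -/
theorem chi0φ_eq_one_iff (C : ChargeData N) (b₀ p ℓ : ℝ) (A : VecField P k) (φ : ScalarField P k N) :
    chi0φ C ℓ (B2.pFn b₀ p ℓ) A φ = 1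
      ↔ B1LowerBound.ChiK P.d b₀ p ℓ (fun x => ‖φ x‖) (fun x => ‖covLaplacianN C Finset.univ A φ x‖) :=
  chiSmall_pFn_eq_one_iff _ _ _ _ _ _

/-- `χ₀(A)` is measurable in `A`. PROVED. [cite: Balaban1982Higgs1, (3.1) p.613] -/
theorem measurable_chi0A (ℓ p : ℝ) : Measurable (chi0A ℓ p : VecField P k → ℝ) := by
  unfold chi0A
  refine measurable_chiSmall _ _ _ (fun x => ?_) (fun x => ?_)
  · exact (((continuous_apply x).comp continuous_toSite).norm).measurable
  · exact (((continuous_negLap_apply x).comp continuous_toSite).norm).measurable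

/-- `χ₀(φ)` is jointly measurable in `(A, φ)`. PROVED. [cite: Balaban1982Higgs1, (3.2) p.613] -/
theorem measurable_chi0φ (C : ChargeData N) (ℓ p : ℝ) :
    Measurable fun q : VecField P k × ScalarField P k N => chi0φ C ℓ p q.1 q.2 := by
  unfold chi0φ
  refine measurable_chiSmall _ _ _ (fun x => ?_) (fun x => ?_)
  · exact (((continuous_apply x).comp continuous_snd).norm).measurable
  · exact ((continuous_covLaplacianN_apply C x).norm).measurable

/-- **The inner weight of (3.6), `(A, φ) ↦ χ₀(A)χ₀(φ)`, is jointly measurable** — the hypothesis `hχ₀` of the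
concrete (3.6) (`B1Ineq36HiggsModel.lowerStep36`). PROVED. [cite: Balaban1982Higgs1, (3.6) p.613] -/
theorem measurable_chi0 (C : ChargeData N) (ℓ p : ℝ) :
    Measurable fun q : VecField P k × ScalarField P k N => chi0A ℓ p q.1 * chi0φ C ℓ p q.1 q.2 :=
  ((measurable_chi0A ℓ p).comp measurable_fst).mul (measurable_chi0φ C ℓ p)

/-- The inner weight takes values in `[0, 1]` (hypothesis `c₀` of the concrete (3.6)). [cite: Balaban1982Higgs1, (3.6) p.613] -/
theorem chi0_mem_Icc (C : ChargeData N) (ℓ p : ℝ) (A : VecField P k) (φ : ScalarField P k N) :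
    chi0A ℓ p A * chi0φ C ℓ p A φ ∈ Set.Icc (0 : ℝ) 1 :=
  ⟨mul_nonneg (chi0A_mem_Icc ℓ p A).1 (chi0φ_mem_Icc C ℓ p A φ).1,
    mul_le_one₀ (chi0A_mem_Icc ℓ p A).2 (chi0φ_mem_Icc C ℓ p A φ).1 (chi0φ_mem_Icc C ℓ p A φ).2⟩

end ChiZero

/-! ## 4. (3.29)/(3.3): the background configurations; (3.27)–(3.28)/(3.4)–(3.5): `χ_k(A)`, `χ_k(φ)`, `χ₁(B)`, `χ₁(ψ)` -/

section ChiK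

variable {N : ℕ}

/-- **(3.29) p. 617, first formula**: `A^{(k),ε} = a_k(L^kε)^{−2}G^ε_kQ^*_kA` for a vector field `A` on `T^{(k)}_{L^kε}`
— this IS `B3MultiscaleFields.topPiece μ₀² a k A` (r15: the vector-field propagator `G^ε_k` =
`HiggsCovariance.propagatorK` on the whole torus at the zero external field with the vector-field mass `μ₀²`, `Q_k^*` =
`HiggsCovariance.avgQkAdj`, `a_k` = `B1.aSeq a L k`, assembled by `B1LowerBound.bgField`), recorded under the (3.29)
tag as an abbreviation; no new object. [cite: Balaban1982Higgs1, (3.29) p.617] -/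
noncomputable abbrev bgVec (mu0sq a : ℝ) (k : ℕ) (A : VecField P k) : VecField P 0 := topPiece mu0sq a k A

/-- (3.29)/(3.3) for the vector field, unfolded to the printed combination `a_k(L^kε)^{−2}·G^ε_k(Q_k^*A)` on
`ℝ^d`-valued site functions. [cite: Balaban1982Higgs1, (3.29) p.617] -/
theorem toSite_bgVec (mu0sq a : ℝ) (k : ℕ) (A : VecField P k) :
    toSite (bgVec (P := P) mu0sq a k A)
      = (B1.aSeq a P.L k * (P.mesh k ^ 2)⁻¹) •
          propagatorK (zeroCharge P.d) Finset.univ (0 : VecField P 0) mu0sq a k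
            (avgQkAdj (zeroCharge P.d) (0 : VecField P 0) k (toSite A)) := by
  simp [bgVec, topPiece, toSite_ofSite, B3MultiscaleFields.fluctOp_eq]

/-- **(3.29) p. 617, second formula**: `φ^{(k),ε} = a_k(L^kε)^{−2}G^ε_k(A^{(k),ε})Q^*_k(A^{(k),ε})φ` for a scalar field
`φ` on `T^{(k)}` and a background vector field `A^{(k),ε}` on `T_ε` (`Abg`): r14's `B1LowerBound.bgField` at the
CONCRETE covariant propagator `G^ε_k(A^{(k),ε})` = `HiggsCovariance.propagatorK C T_ε A^{(k),ε} m² a k` (scalar mass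
`msq ↤ m²` of (1.11)/(2.17) — the renormalized mass, `Couplings.m0sq = m² + δm²`) and the adjoint averaging
`Q^*_k(A^{(k),ε})` = `HiggsCovariance.avgQkAdj`. [cite: Balaban1982Higgs1, (3.29) p.617] -/
noncomputable def bgScalar (C : ChargeData N) (msq a : ℝ) (k : ℕ) (Abg : VecField P 0) (φ : ScalarField P k N) :
    ScalarField P 0 N :=
  B1LowerBound.bgField (B1.aSeq a P.L k) (P.mesh k) (propagatorK C Finset.univ Abg msq a k) (avgQkAdj C Abg k) φ

/-- (3.29) for the scalar field, unfolded: `a_k(L^kε)^{−2}·G^ε_k(A^{(k),ε})(Q^*_k(A^{(k),ε})φ)`. [cite: Balaban1982Higgs1, (3.29) p.617] -/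
theorem bgScalar_eq (C : ChargeData N) (msq a : ℝ) (k : ℕ) (Abg : VecField P 0) (φ : ScalarField P k N) :
    bgScalar C msq a k Abg φ
      = (B1.aSeq a P.L k * (P.mesh k ^ 2)⁻¹) • propagatorK C Finset.univ Abg msq a k (avgQkAdj C Abg k φ) :=
  rfl

/-- (3.29) is linear in `φ` (r14's `bgField_add`). [cite: Balaban1982Higgs1, (3.29) p.617] -/
theorem bgScalar_add (C : ChargeData N) (msq a : ℝ) (k : ℕ) (Abg : VecField P 0) (φ φ' : ScalarField P k N) :
    bgScalar C msq a k Abg (φ + φ') = bgScalar C msq a k Abg φ + bgScalar C msq a k Abg φ' :=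
  B1LowerBound.bgField_add _ _ _ _ φ φ'

/-- **(3.27) p. 617**: `χ_k(A) = Π_{x∈T_ε} χ({|A^{(k),ε}(x)| ≤ (L^kε)^{−(d−2)/2}p(L^kε)}) χ({|(Δ^εA^{(k),ε})(x)| ≤ (L^kε)^{−(d+2)/2}p(L^kε)})`
— the (3.1)-shape restriction of the BACKGROUND field `A^{(k),ε}` (3.29) on `T_ε`, at scale parameter `ℓ` and value `p`
(PRINTED INSTANCE `ℓ = L^kε = P.mesh k`, `p = p(L^kε)`: `chiKA_eq_one_iff`). [cite: Balaban1982Higgs1, (3.27) p.617] -/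
noncomputable def chiKA (ℓ p mu0sq a : ℝ) (k : ℕ) (A : VecField P k) : ℝ :=
  chi0A ℓ p (bgVec mu0sq a k A)

/-- **(3.28) p. 617**: `χ_k(φ) = Π_{x∈T_ε} χ({|φ^{(k),ε}(x)| ≤ (L^kε)^{−(d−2)/2}p(L^kε)}) χ({|(Δ^ε_{A^{(k),ε}}φ^{(k),ε})(x)| ≤ (L^kε)^{−(d+2)/2}p(L^kε)})`
— the (3.2)-shape restriction of the background scalar field `φ^{(k),ε}` (3.29) with the covariant Laplacian of the
background vector field `A^{(k),ε}`; a function of the pair `(A, φ)`. [cite: Balaban1982Higgs1, (3.28) p.617] -/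
noncomputable def chiKφ (C : ChargeData N) (ℓ p mu0sq msq a : ℝ) (k : ℕ) (A : VecField P k)
    (φ : ScalarField P k N) : ℝ :=
  chi0φ C ℓ p (bgVec mu0sq a k A) (bgScalar C msq a k (bgVec mu0sq a k A) φ)

/-- `0 ≤ χ_k(A) ≤ 1`. [cite: Balaban1982Higgs1, (3.27) p.617] -/
theorem chiKA_mem_Icc (ℓ p mu0sq a : ℝ) (k : ℕ) (A : VecField P k) :
    chiKA (P := P) ℓ p mu0sq a k A ∈ Set.Icc (0 : ℝ) 1 :=
  chi0A_mem_Icc _ _ _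

/-- `0 ≤ χ_k(φ) ≤ 1`. [cite: Balaban1982Higgs1, (3.28) p.617] -/
theorem chiKφ_mem_Icc (C : ChargeData N) (ℓ p mu0sq msq a : ℝ) (k : ℕ) (A : VecField P k)
    (φ : ScalarField P k N) : chiKφ C ℓ p mu0sq msq a k A φ ∈ Set.Icc (0 : ℝ) 1 :=
  chi0φ_mem_Icc _ _ _ _ _

/-- **`χ_k(A) = 1 ↔` r14's `ChiK`** at scale `ℓ` for the size functions `|A^{(k),ε}(x)|`, `|(Δ^εA^{(k),ε})(x)|` of the
model (rows B1.Eq3.27/B1.Eq3.27-3.28 of record, instantiated; printed `ℓ = L^kε`). PROVED. [cite: Balaban1982Higgs1, (3.27) p.617] -/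
theorem chiKA_eq_one_iff (b₀ p ℓ mu0sq a : ℝ) (k : ℕ) (A : VecField P k) :
    chiKA ℓ (B2.pFn b₀ p ℓ) mu0sq a k A = 1
      ↔ B1LowerBound.ChiK P.d b₀ p ℓ (fun x => ‖toSite (bgVec (P := P) mu0sq a k A) x‖)
          (fun x => ‖negLap (toSite (bgVec (P := P) mu0sq a k A)) x‖) :=
  chi0A_eq_one_iff _ _ _ _

/-- **`χ_k(φ) = 1 ↔` r14's `ChiK`** for the size functions `|φ^{(k),ε}(x)|`, `|(Δ^ε_{A^{(k),ε}}φ^{(k),ε})(x)|`. PROVED. [cite: Balaban1982Higgs1, (3.28) p.617] -/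
theorem chiKφ_eq_one_iff (C : ChargeData N) (b₀ p ℓ mu0sq msq a : ℝ) (k : ℕ) (A : VecField P k)
    (φ : ScalarField P k N) :
    chiKφ C ℓ (B2.pFn b₀ p ℓ) mu0sq msq a k A φ = 1
      ↔ B1LowerBound.ChiK P.d b₀ p ℓ (fun x => ‖bgScalar C msq a k (bgVec mu0sq a k A) φ x‖)
          (fun x => ‖covLaplacianN C Finset.univ (bgVec mu0sq a k A)
            (bgScalar C msq a k (bgVec mu0sq a k A) φ) x‖) :=
  chi0φ_eq_one_iff _ _ _ _ _ _

/-- **(3.3) p. 613, first formula**: `B^{(1),ε} = a(Lε)^{−2}G^ε_1Q^*B` — the case `k = 1` of (3.29) (`a₁ = a`,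
`B1.aSeq_one`). [cite: Balaban1982Higgs1, (3.3) p.613] -/
noncomputable abbrev bgVec1 (mu0sq a : ℝ) (B : VecField P 1) : VecField P 0 := bgVec mu0sq a 1 B

/-- **(3.3) p. 613, second formula**: `ψ^{(1),ε} = a(Lε)^{−2}G^ε_1(B^{(1),ε})Q^*(B^{(1),ε})ψ` — the case `k = 1` of
(3.29) at the background field `B^{(1),ε}`. [cite: Balaban1982Higgs1, (3.3) p.613] -/
noncomputable abbrev bgScalar1 (C : ChargeData N) (mu0sq msq a : ℝ) (B : VecField P 1) (ψ : ScalarField P 1 N) :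
    ScalarField P 0 N :=
  bgScalar C msq a 1 (bgVec1 mu0sq a B) ψ

/-- With `L > 1` the coefficient of (3.3) is the printed `a(Lε)^{−2}` (`a₁ = a`). PROVED. [cite: Balaban1982Higgs1, (3.3) p.613] -/
theorem bgScalar1_eq (C : ChargeData N) (mu0sq msq a : ℝ) (hL : 1 < (P.L : ℝ)) (B : VecField P 1)
    (ψ : ScalarField P 1 N) :
    bgScalar1 C mu0sq msq a B ψ
      = (a * (P.mesh 1 ^ 2)⁻¹) •
          propagatorK C Finset.univ (bgVec1 mu0sq a B) msq a 1 (avgQkAdj C (bgVec1 mu0sq a B) 1 ψ) := by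
  rw [bgScalar1, bgScalar_eq, B1.aSeq_one hL]

/-- **(3.4) p. 613**: `χ₁(B)` = the restriction of `B^{(1),ε}` at scale `Lε` — the case `k = 1` of (3.27)
(PRINTED INSTANCE `ℓ = Lε = P.mesh 1`, `p = p(Lε)`). [cite: Balaban1982Higgs1, (3.4) p.613] -/
noncomputable abbrev chi1B (ℓ p mu0sq a : ℝ) (B : VecField P 1) : ℝ := chiKA ℓ p mu0sq a 1 B

/-- **(3.5) p. 613**: `χ₁(ψ)` = the restriction of `ψ^{(1),ε}` with the covariant Laplacian of `B^{(1),ε}` — the case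
`k = 1` of (3.28); a function of `(B, ψ)`. [cite: Balaban1982Higgs1, (3.5) p.613] -/
noncomputable abbrev chi1ψ (C : ChargeData N) (ℓ p mu0sq msq a : ℝ) (B : VecField P 1) (ψ : ScalarField P 1 N) : ℝ :=
  chiKφ C ℓ p mu0sq msq a 1 B ψ

/-- **The outer weight of (3.6), `(B, ψ) ↦ χ₁(B)χ₁(ψ)`, takes values in `[0, 1]`** — the only property of `χ₁` the
inequality (3.6) uses (hypothesis `c₁` of `B1Ineq36HiggsModel.lowerStep36`). PROVED. [cite: Balaban1982Higgs1, (3.6) p.613] -/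
theorem chi1_mem_Icc (C : ChargeData N) (ℓ p mu0sq msq a : ℝ) (B : VecField P 1) (ψ : ScalarField P 1 N) :
    chi1B ℓ p mu0sq a B * chi1ψ C ℓ p mu0sq msq a B ψ ∈ Set.Icc (0 : ℝ) 1 :=
  ⟨mul_nonneg (chiKA_mem_Icc ℓ p mu0sq a 1 B).1 (chiKφ_mem_Icc C ℓ p mu0sq msq a 1 B ψ).1,
    mul_le_one₀ (chiKA_mem_Icc ℓ p mu0sq a 1 B).2 (chiKφ_mem_Icc C ℓ p mu0sq msq a 1 B ψ).1
      (chiKφ_mem_Icc C ℓ p mu0sq msq a 1 B ψ).2⟩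

/-- The general outer weight `χ_k(A)χ_k(φ)` of the induction hypothesis (3.26) p. 617 takes values in `[0, 1]`. [cite: Balaban1982Higgs1, (3.26) p.617] -/
theorem chiK_mem_Icc (C : ChargeData N) (ℓ p mu0sq msq a : ℝ) (k : ℕ) (A : VecField P k) (φ : ScalarField P k N) :
    chiKA ℓ p mu0sq a k A * chiKφ C ℓ p mu0sq msq a k A φ ∈ Set.Icc (0 : ℝ) 1 :=
  ⟨mul_nonneg (chiKA_mem_Icc ℓ p mu0sq a k A).1 (chiKφ_mem_Icc C ℓ p mu0sq msq a k A φ).1,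
    mul_le_one₀ (chiKA_mem_Icc ℓ p mu0sq a k A).2 (chiKφ_mem_Icc C ℓ p mu0sq msq a k A φ).1
      (chiKφ_mem_Icc C ℓ p mu0sq msq a k A φ).2⟩

/-- `χ_k(A)` is measurable in `A` (the background field (3.29) is linear, hence continuous, in `A`:
`B3MultiscaleFields.topPiece` is a composite of linear maps on finite-dimensional spaces). PROVED. [cite: Balaban1982Higgs1, (3.27) p.617] -/
theorem measurable_chiKA (ℓ p mu0sq a : ℝ) (k : ℕ) :
    Measurable (chiKA (P := P) ℓ p mu0sq a k : VecField P k → ℝ) := by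
  have hlin : IsLinearMap ℝ fun A : VecField P k => toSite (bgVec (P := P) mu0sq a k A) := by
    refine ⟨fun A B => ?_, fun c A => ?_⟩
    · simp only [toSite_bgVec, B3MultiscaleFields.toSite_add, map_add, smul_add]
    · rw [toSite_bgVec, toSite_bgVec]
      have hs : toSite (c • A) = c • toSite A := by
        funext x
        ext μ
        rfl
      rw [hs, map_smul, map_smul, smul_comm]
  have hcont : Continuous fun A : VecField P k => toSite (bgVec (P := P) mu0sq a k A) :=
    (hlin.mk' _).continuous_of_finiteDimensional
  unfold chiKA chi0A
  refine measurable_chiSmall _ _ _ (fun x => ?_) (fun x => ?_)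
  · exact (((continuous_apply x).comp hcont).norm).measurable
  · exact (((continuous_negLap_apply x).comp hcont).norm).measurable

end ChiK

end Literature.MathematicalPhysics.QuantumFieldTheory.Balaban1983to89.B1Eq31Concrete
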